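import Mathlib
import HarnessLib
import Summits.Ventures.LatticeQCDFlow.Scaling.TorusRankedMorseCount
import Summits.Ventures.LatticeQCDFlow.Scaling.TorusPlaquetteLastLinks

/-!
# LatticeQCDFlow / Scaling — CLOSING SECTIONS of ranked plaquette structures: every optimal structure of
# `(ℤ/L)^d` has one of size `s` with `(2d−3)·s ≥ k`

HONEST FRAMING: exact (Metropolis-corrected) sampling algorithms for lattice gauge theory;
figures of merit are autocorrelation/cost numbers at stated couplings and volumes; no
continuum-physics claim.

Venture `LatticeQCDFlow` (cell pub-lqcd), topic `Scaling`, FANOUT row 30 (lean-1, GEN-26) — OUR WORK on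
THEORY-2.md §4 row C5, the combinatorial input of the LOWER half of the volume law.
`Scaling/PlaquettePeelingClosingBound` bounds the full partition function by `c^{#B} M^{k−s} M₂^{s}` for a
ranked structure `(B, t, rank)` with a CLOSING SECTION `(S, u)` of size `s`: `S` outside `B`, `u` injective
on `S` into `B`, `t (u p')` a link of `p'`, and `rank p < rank (u p')` for every other `p ∈ B` whose top
link lies on `p'` — along a compatible order the uncovered plaquette `p'` is CLOSED by the heat-bath
draw of the covered plaquette `u p'`.  Here: how large a closing section the optimal structures of
`Scaling/TorusRankedMorseCount` (`k = k_min(d, L) = (d−1)(d−2)/2·L^d + (d−1)`) admit.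

* §1 **`exists_injective_rank`** — every peeling rank refines to an INJECTIVE one (lexicographic with an
  enumeration of the plaquettes), so «the covered plaquette of largest rank whose top link lies on `p'`» is
  well defined;
* §2 **`exists_topLink_mem_of_optimal`** — in a structure attaining `k_min` EVERY uncovered plaquette
  carries the top link of a covered one (else it could be adjoined with a fresh top link and the lowest
  rank, against the homology bound of `Scaling/TorusRankedHomologyBound`): at the moment an uncovered
  plaquette closes, its closing link is being heat-bathed for another plaquette;
* §3 **`exists_closingSection`** — for an injective rank, the plaquettes outside `B` that carry a top link
  admit a closing section `S` with `#{p' ∉ B carrying a top link} ≤ (2(d−1) − 1)·#S` (a link lies on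
  `2(d−1)` plaquettes, `TorusPlaquetteLastLinks.card_filter_mem_plaquetteLinks_le`, one of which is the
  covered plaquette it tops);
* §4 **`exists_closingSection_of_optimal`** — hence every optimal structure has, for a refined rank, a
  closing section with `k ≤ (2d−3)·s`; **`exists_optimal_closingSection`** (every `d`, `L ≥ 2`: a ranked
  structure with `k = k_min` AND such a section exists) and **`exists_optimal_closingSection_three`**
  (`d = 3`: `k = L³ + 2 ≤ 3s`).

No `def`, no `sorry`, nothing cited as a fact.
-/

namespace Summit.Ventures.LatticeQCDFlow.Theory2.Autoregressive

open Finset Function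
open Literature.MathematicalPhysics.QuantumFieldTheory Literature.MathematicalPhysics.QuantumLattice

variable {d L : ℕ} [NeZero L]

/-! ## §1 Refining a peeling rank to an injective one -/

/-- **Injective refinement of a peeling rank.**  `rank' p = rank p · N + e(p)` (`e` an enumeration of the
plaquettes, `N` their number plus one) is injective and is again a peeling rank for `(B, t)`. [ours] -/
theorem exists_injective_rank (B : Finset (Plaquette d L)) (t : Plaquette d L → Edge d L)
    (rank : Plaquette d L → ℕ)
    (hrank : ∀ p ∈ B, ∀ p' ∈ B, p ≠ p' → t p ∈ ({(p'.1, p'.2.1.1), (p'.1.shift p'.2.1.1, p'.2.1.2),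
        (p'.1.shift p'.2.1.2, p'.2.1.1), (p'.1, p'.2.1.2)} : Finset (Edge d L)) → rank p < rank p') :
    ∃ rank' : Plaquette d L → ℕ, Function.Injective rank' ∧
      ∀ p ∈ B, ∀ p' ∈ B, p ≠ p' → t p ∈ ({(p'.1, p'.2.1.1), (p'.1.shift p'.2.1.1, p'.2.1.2),
        (p'.1.shift p'.2.1.2, p'.2.1.1), (p'.1, p'.2.1.2)} : Finset (Edge d L)) → rank' p < rank' p' := by
  classical
  set N : ℕ := Fintype.card (Plaquette d L) + 1 with hN
  set e := Fintype.equivFin (Plaquette d L) with he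
  have hlt : ∀ p : Plaquette d L, ((e p : ℕ)) < N := fun p => Nat.lt_succ_of_lt (e p).isLt
  refine ⟨fun p => rank p * N + e p, ?_, ?_⟩
  · intro p q h
    simp only at h
    have h1 : (rank p * N + (e p : ℕ)) % N = (rank q * N + (e q : ℕ)) % N := by rw [h]
    rw [add_comm (rank p * N), add_comm (rank q * N), Nat.add_mul_mod_self_right,
      Nat.add_mul_mod_self_right, Nat.mod_eq_of_lt (hlt p), Nat.mod_eq_of_lt (hlt q)] at h1
    exact e.injective (Fin.ext h1)
  · intro p hp q hq hne hmem
    have h := hrank p hp q hq hne hmem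
    show rank p * N + (e p : ℕ) < rank q * N + (e q : ℕ)
    have h1 : rank p * N + (e p : ℕ) < (rank p + 1) * N := by
      have := hlt p; rw [add_mul, one_mul]; omega
    have h2 : (rank p + 1) * N ≤ rank q * N := Nat.mul_le_mul_right _ h
    omega

/-! ## §2 In an optimal structure every uncovered plaquette carries a top link -/

/-- **Every uncovered plaquette of an optimal ranked structure carries a top link.**  `L ≥ 2`;
`(B, t, rank)` ranked with `#Bᶜ = k_min(d, L) = (d−1)(d−2)/2·L^d + (d−1)`.  Then for every `p' ∉ B` some
covered `p ∈ B` has `t p` among the four links of `p'` — otherwise `B ∪ {p'}` (top link: any link of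
`p'`; rank: below everything) is ranked with `k_min − 1` plaquettes outside, against
`TorusRankedHomologyBound.homologyBound_closed_form`. [ours] -/
theorem exists_topLink_mem_of_optimal (hL : 2 ≤ L) (B : Finset (Plaquette d L))
    (t : Plaquette d L → Edge d L)
    (ht : ∀ p ∈ B, t p ∈ ({(p.1, p.2.1.1), (p.1.shift p.2.1.1, p.2.1.2),
        (p.1.shift p.2.1.2, p.2.1.1), (p.1, p.2.1.2)} : Finset (Edge d L)))
    (rank : Plaquette d L → ℕ)
    (hrank : ∀ p ∈ B, ∀ p' ∈ B, p ≠ p' → t p ∈ ({(p'.1, p'.2.1.1), (p'.1.shift p'.2.1.1, p'.2.1.2),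
        (p'.1.shift p'.2.1.2, p'.2.1.1), (p'.1, p'.2.1.2)} : Finset (Edge d L)) → rank p < rank p')
    (hopt : (Finset.univ \ B).card = (d - 1) * (d - 2) / 2 * L ^ d + (d - 1))
    {p' : Plaquette d L} (hp' : p' ∉ B) :
    ∃ p ∈ B, t p ∈ ({(p'.1, p'.2.1.1), (p'.1.shift p'.2.1.1, p'.2.1.2),
        (p'.1.shift p'.2.1.2, p'.2.1.1), (p'.1, p'.2.1.2)} : Finset (Edge d L)) := by
  classical
  by_contra hno
  push Not at hno
  set B' : Finset (Plaquette d L) := insert p' B with hB'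
  set t' : Plaquette d L → Edge d L := Function.update t p' (p'.1, p'.2.1.1) with ht'def
  set rank' : Plaquette d L → ℕ := fun p => if p = p' then 0 else rank p + 1 with hrank'def
  have hne_of_mem : ∀ p ∈ B, p ≠ p' := fun p hp h => hp' (h ▸ hp)
  have ht' : ∀ p ∈ B', t' p ∈ ({(p.1, p.2.1.1), (p.1.shift p.2.1.1, p.2.1.2),
      (p.1.shift p.2.1.2, p.2.1.1), (p.1, p.2.1.2)} : Finset (Edge d L)) := by
    intro p hp
    rcases Finset.mem_insert.1 hp with rfl | hpB
    · simp [ht'def]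
    · rw [ht'def, Function.update_of_ne (hne_of_mem p hpB)]; exact ht p hpB
  have hrank' : ∀ p ∈ B', ∀ q ∈ B', p ≠ q → t' p ∈ ({(q.1, q.2.1.1), (q.1.shift q.2.1.1, q.2.1.2),
      (q.1.shift q.2.1.2, q.2.1.1), (q.1, q.2.1.2)} : Finset (Edge d L)) → rank' p < rank' q := by
    intro p hp q hq hne hmem
    rcases Finset.mem_insert.1 hp with rfl | hpB <;> rcases Finset.mem_insert.1 hq with rfl | hqB
    · exact absurd rfl hne
    · have hq' := hne_of_mem q hqB
      simp [hrank'def, hq']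
    · have hp'' := hne_of_mem p hpB
      rw [ht'def, Function.update_of_ne hp''] at hmem
      exact absurd hmem (hno p hpB)
    · have hp'' := hne_of_mem p hpB
      have hq'' := hne_of_mem q hqB
      rw [ht'def, Function.update_of_ne hp''] at hmem
      have h := hrank p hpB q hqB hne hmem
      simp only [hrank'def, hp'', hq'', if_false]
      omega
  have hbound := homologyBound_closed_form hL B' t' ht' rank' hrank'
  have hmem' : p' ∈ Finset.univ \ B := Finset.mem_sdiff.2 ⟨Finset.mem_univ _, hp'⟩
  have hsd : Finset.univ \ B' = (Finset.univ \ B).erase p' := by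
    ext q
    simp only [hB', Finset.mem_sdiff, Finset.mem_univ, true_and, Finset.mem_insert, not_or,
      Finset.mem_erase]
  have hcard : (Finset.univ \ B').card + 1 = (Finset.univ \ B).card := by
    rw [hsd, Finset.card_erase_of_mem hmem']
    have : 0 < (Finset.univ \ B).card := Finset.card_pos.2 ⟨p', hmem'⟩
    omega
  have hE := two_mul_choose_coeff d
  have h3 : (d - 1) * (d - 2) * L ^ d = 2 * ((d - 1) * (d - 2) / 2 * L ^ d) := by rw [← mul_assoc, hE]
  omega

/-! ## §3 Closing sections -/

/-- **Closing sections exist.**  `(B, t, rank)` ranked with `rank` INJECTIVE on `B`.  Let `T` be the set of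
plaquettes outside `B` that carry the top link of some covered plaquette.  Then there are `S ⊆ T` and `u`
with: `u p' ∈ B`, `t (u p')` a link of `p'`, `rank p < rank (u p')` for every other covered `p` whose top
link lies on `p'`, `u` injective on `S` — and `#T ≤ (2(d−1) − 1)·#S` (take `u p'` of maximal rank and one
`p'` per value of `u`; a link lies on `2(d−1)` plaquettes, one of which is the covered plaquette it tops).
[ours] -/
theorem exists_closingSection (B : Finset (Plaquette d L)) (t : Plaquette d L → Edge d L)
    (ht : ∀ p ∈ B, t p ∈ ({(p.1, p.2.1.1), (p.1.shift p.2.1.1, p.2.1.2),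
        (p.1.shift p.2.1.2, p.2.1.1), (p.1, p.2.1.2)} : Finset (Edge d L)))
    (rank : Plaquette d L → ℕ) (hrinj : Set.InjOn rank B) :
    ∃ (S : Finset (Plaquette d L)) (u : Plaquette d L → Plaquette d L),
      (∀ p' ∈ S, p' ∉ B) ∧ (∀ p' ∈ S, u p' ∈ B) ∧
      (∀ p' ∈ S, t (u p') ∈ ({(p'.1, p'.2.1.1), (p'.1.shift p'.2.1.1, p'.2.1.2),
        (p'.1.shift p'.2.1.2, p'.2.1.1), (p'.1, p'.2.1.2)} : Finset (Edge d L))) ∧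
      (∀ p' ∈ S, ∀ p ∈ B, p ≠ u p' → t p ∈ ({(p'.1, p'.2.1.1), (p'.1.shift p'.2.1.1, p'.2.1.2),
        (p'.1.shift p'.2.1.2, p'.2.1.1), (p'.1, p'.2.1.2)} : Finset (Edge d L)) → rank p < rank (u p')) ∧
      Set.InjOn u S ∧
      ((Finset.univ \ B).filter (fun p' => ∃ p ∈ B, t p ∈ ({(p'.1, p'.2.1.1),
        (p'.1.shift p'.2.1.1, p'.2.1.2), (p'.1.shift p'.2.1.2, p'.2.1.1), (p'.1, p'.2.1.2)} :
          Finset (Edge d L)))).card ≤ (2 * (d - 1) - 1) * S.card := by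
  classical
  set T : Finset (Plaquette d L) := (Finset.univ \ B).filter (fun p' => ∃ p ∈ B, t p ∈ ({(p'.1, p'.2.1.1),
    (p'.1.shift p'.2.1.1, p'.2.1.2), (p'.1.shift p'.2.1.2, p'.2.1.1), (p'.1, p'.2.1.2)} :
      Finset (Edge d L))) with hT
  -- the covered plaquette of maximal rank whose top link lies on `p'`
  have hex : ∀ p', p' ∈ T → ∃ p, p ∈ B ∧ t p ∈ ({(p'.1, p'.2.1.1), (p'.1.shift p'.2.1.1, p'.2.1.2),
      (p'.1.shift p'.2.1.2, p'.2.1.1), (p'.1, p'.2.1.2)} : Finset (Edge d L)) ∧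
      ∀ q ∈ B, t q ∈ ({(p'.1, p'.2.1.1), (p'.1.shift p'.2.1.1, p'.2.1.2),
        (p'.1.shift p'.2.1.2, p'.2.1.1), (p'.1, p'.2.1.2)} : Finset (Edge d L)) → rank q ≤ rank p := by
    intro p' hp'
    obtain ⟨-, p₀, hp₀, hp₀m⟩ := Finset.mem_filter.1 hp'
    obtain ⟨p, hpC, hpmax⟩ := Finset.exists_max_image (B.filter (fun p => t p ∈ ({(p'.1, p'.2.1.1),
      (p'.1.shift p'.2.1.1, p'.2.1.2), (p'.1.shift p'.2.1.2, p'.2.1.1), (p'.1, p'.2.1.2)} :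
        Finset (Edge d L)))) rank ⟨p₀, Finset.mem_filter.2 ⟨hp₀, hp₀m⟩⟩
    exact ⟨p, (Finset.mem_filter.1 hpC).1, (Finset.mem_filter.1 hpC).2,
      fun q hq hqm => hpmax q (Finset.mem_filter.2 ⟨hq, hqm⟩)⟩
  choose! u huB hut humax using hex
  -- one preimage per value of `u`
  have hsec : ∀ a, a ∈ T.image u → ∃ p', p' ∈ T ∧ u p' = a := fun a ha => by
    simpa only [Finset.mem_image] using ha
  choose! g hgT hug using hsec
  have hST : ∀ p' ∈ (T.image u).image g, p' ∈ T := by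
    intro p' hp'
    obtain ⟨a, ha, rfl⟩ := Finset.mem_image.1 hp'
    exact hgT a ha
  have hTB : ∀ p' ∈ T, p' ∉ B := fun p' hp' =>
    (Finset.mem_sdiff.1 (Finset.mem_filter.1 hp').1).2
  refine ⟨(T.image u).image g, u, fun p' hp' => hTB p' (hST p' hp'), fun p' hp' => huB p' (hST p' hp'),
    fun p' hp' => hut p' (hST p' hp'), ?_, ?_, ?_⟩
  · intro p' hp' p hp hne hmem
    have hT' := hST p' hp'
    have hle := humax p' hT' p hp hmem
    exact lt_of_le_of_ne hle fun h => hne (hrinj hp (huB p' hT') h)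
  · intro x hx y hy hxy
    obtain ⟨a, ha, rfl⟩ := Finset.mem_image.1 hx
    obtain ⟨b, hb, rfl⟩ := Finset.mem_image.1 hy
    rw [hug a ha, hug b hb] at hxy
    rw [hxy]
  · have hginj : Set.InjOn g (T.image u) := fun a ha b hb h => by
      rw [← hug a ha, ← hug b hb, h]
    rw [Finset.card_image_of_injOn hginj]
    -- every fibre of `u` over `a` consists of plaquettes `≠ a` carrying the link `t a`
    have hfib : ∀ a ∈ T.image u, (T.filter (fun p' => u p' = a)).card ≤ 2 * (d - 1) - 1 := by
      intro a ha
      obtain ⟨p₁, hp₁, hp₁a⟩ := Finset.mem_image.1 ha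
      have haB : a ∈ B := hp₁a ▸ huB p₁ hp₁
      have hsub : T.filter (fun p' => u p' = a) ⊆
          ((Finset.univ : Finset (Plaquette d L)).filter (fun p => t a ∈ ({(p.1, p.2.1.1),
            (p.1.shift p.2.1.1, p.2.1.2), (p.1.shift p.2.1.2, p.2.1.1), (p.1, p.2.1.2)} :
              Finset (Edge d L)))).erase a := by
        intro p' hp'
        obtain ⟨hp'T, hp'a⟩ := Finset.mem_filter.1 hp'
        refine Finset.mem_erase.2 ⟨fun h => hTB p' hp'T (h ▸ haB), Finset.mem_filter.2 ⟨Finset.mem_univ _, ?_⟩⟩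
        have h := hut p' hp'T
        rwa [hp'a] at h
      have hmem : a ∈ (Finset.univ : Finset (Plaquette d L)).filter (fun p => t a ∈ ({(p.1, p.2.1.1),
          (p.1.shift p.2.1.1, p.2.1.2), (p.1.shift p.2.1.2, p.2.1.1), (p.1, p.2.1.2)} :
            Finset (Edge d L))) := Finset.mem_filter.2 ⟨Finset.mem_univ _, ht a haB⟩
      have hle := card_filter_mem_plaquetteLinks_le (d := d) (L := L) (t a)
      calc (T.filter (fun p' => u p' = a)).card
          ≤ (((Finset.univ : Finset (Plaquette d L)).filter (fun p => t a ∈ ({(p.1, p.2.1.1),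
              (p.1.shift p.2.1.1, p.2.1.2), (p.1.shift p.2.1.2, p.2.1.1), (p.1, p.2.1.2)} :
                Finset (Edge d L)))).erase a).card := Finset.card_le_card hsub
        _ = ((Finset.univ : Finset (Plaquette d L)).filter (fun p => t a ∈ ({(p.1, p.2.1.1),
              (p.1.shift p.2.1.1, p.2.1.2), (p.1.shift p.2.1.2, p.2.1.1), (p.1, p.2.1.2)} :
                Finset (Edge d L)))).card - 1 := Finset.card_erase_of_mem hmem
        _ ≤ 2 * (d - 1) - 1 := Nat.sub_le_sub_right hle 1
    calc T.card = ∑ a ∈ T.image u, (T.filter (fun p' => u p' = a)).card :=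
          Finset.card_eq_sum_card_fiberwise fun p' hp' => Finset.mem_image_of_mem u hp'
      _ ≤ ∑ a ∈ T.image u, (2 * (d - 1) - 1) := Finset.sum_le_sum hfib
      _ = (2 * (d - 1) - 1) * (T.image u).card := by rw [Finset.sum_const, smul_eq_mul, mul_comm]

/-! ## §4 Optimal structures -/

/-- **Every optimal structure has a closing section with `k ≤ (2d−3)·s`** (`L ≥ 2`; `(B, t, rank)` ranked
with `#Bᶜ = k_min(d, L)`): for a refined (injective) peeling rank `rank'` of the same `(B, t)` there is a
closing section `(S, u)` with `#Bᶜ ≤ (2(d−1) − 1)·#S`. [ours] -/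
theorem exists_closingSection_of_optimal (hL : 2 ≤ L) (B : Finset (Plaquette d L))
    (t : Plaquette d L → Edge d L)
    (ht : ∀ p ∈ B, t p ∈ ({(p.1, p.2.1.1), (p.1.shift p.2.1.1, p.2.1.2),
        (p.1.shift p.2.1.2, p.2.1.1), (p.1, p.2.1.2)} : Finset (Edge d L)))
    (rank : Plaquette d L → ℕ)
    (hrank : ∀ p ∈ B, ∀ p' ∈ B, p ≠ p' → t p ∈ ({(p'.1, p'.2.1.1), (p'.1.shift p'.2.1.1, p'.2.1.2),
        (p'.1.shift p'.2.1.2, p'.2.1.1), (p'.1, p'.2.1.2)} : Finset (Edge d L)) → rank p < rank p')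
    (hopt : (Finset.univ \ B).card = (d - 1) * (d - 2) / 2 * L ^ d + (d - 1)) :
    ∃ (rank' : Plaquette d L → ℕ) (S : Finset (Plaquette d L)) (u : Plaquette d L → Plaquette d L),
      (∀ p ∈ B, ∀ p' ∈ B, p ≠ p' → t p ∈ ({(p'.1, p'.2.1.1), (p'.1.shift p'.2.1.1, p'.2.1.2),
        (p'.1.shift p'.2.1.2, p'.2.1.1), (p'.1, p'.2.1.2)} : Finset (Edge d L)) → rank' p < rank' p') ∧
      (∀ p' ∈ S, p' ∉ B) ∧ (∀ p' ∈ S, u p' ∈ B) ∧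
      (∀ p' ∈ S, t (u p') ∈ ({(p'.1, p'.2.1.1), (p'.1.shift p'.2.1.1, p'.2.1.2),
        (p'.1.shift p'.2.1.2, p'.2.1.1), (p'.1, p'.2.1.2)} : Finset (Edge d L))) ∧
      (∀ p' ∈ S, ∀ p ∈ B, p ≠ u p' → t p ∈ ({(p'.1, p'.2.1.1), (p'.1.shift p'.2.1.1, p'.2.1.2),
        (p'.1.shift p'.2.1.2, p'.2.1.1), (p'.1, p'.2.1.2)} : Finset (Edge d L)) → rank' p < rank' (u p')) ∧
      Set.InjOn u S ∧ (Finset.univ \ B).card ≤ (2 * (d - 1) - 1) * S.card := by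
  classical
  obtain ⟨rank', hinj', hrank'⟩ := exists_injective_rank B t rank hrank
  obtain ⟨S, u, h1, h2, h3, h4, h5, h6⟩ := exists_closingSection B t ht rank' (hinj'.injOn)
  have hT : (Finset.univ \ B).filter (fun p' => ∃ p ∈ B, t p ∈ ({(p'.1, p'.2.1.1),
      (p'.1.shift p'.2.1.1, p'.2.1.2), (p'.1.shift p'.2.1.2, p'.2.1.1), (p'.1, p'.2.1.2)} :
        Finset (Edge d L))) = Finset.univ \ B :=
    Finset.filter_true_of_mem fun p' hp' =>
      exists_topLink_mem_of_optimal hL B t ht rank hrank hopt (Finset.mem_sdiff.1 hp').2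
  rw [hT] at h6
  exact ⟨rank', S, u, hrank', h1, h2, h3, h4, h5, h6⟩

/-- **Every `(ℤ/L)^d` (`L ≥ 2`) has an optimal ranked structure WITH a closing section of size `s`,
`k_min(d, L) = (d−1)(d−2)/2·L^d + (d−1) ≤ (2(d−1) − 1)·s`** — the Morse structure of
`TorusRankedMorseCount` with a refined rank. [ours] -/
theorem exists_optimal_closingSection (hL : 2 ≤ L) :
    ∃ (B : Finset (Plaquette d L)) (t : Plaquette d L → Edge d L) (rank : Plaquette d L → ℕ)
      (S : Finset (Plaquette d L)) (u : Plaquette d L → Plaquette d L),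
      (∀ p ∈ B, t p ∈ ({(p.1, p.2.1.1), (p.1.shift p.2.1.1, p.2.1.2),
        (p.1.shift p.2.1.2, p.2.1.1), (p.1, p.2.1.2)} : Finset (Edge d L))) ∧
      (∀ p ∈ B, ∀ p' ∈ B, p ≠ p' → t p ∈ ({(p'.1, p'.2.1.1), (p'.1.shift p'.2.1.1, p'.2.1.2),
        (p'.1.shift p'.2.1.2, p'.2.1.1), (p'.1, p'.2.1.2)} : Finset (Edge d L)) → rank p < rank p') ∧
      (∀ p' ∈ S, p' ∉ B) ∧ (∀ p' ∈ S, u p' ∈ B) ∧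
      (∀ p' ∈ S, t (u p') ∈ ({(p'.1, p'.2.1.1), (p'.1.shift p'.2.1.1, p'.2.1.2),
        (p'.1.shift p'.2.1.2, p'.2.1.1), (p'.1, p'.2.1.2)} : Finset (Edge d L))) ∧
      (∀ p' ∈ S, ∀ p ∈ B, p ≠ u p' → t p ∈ ({(p'.1, p'.2.1.1), (p'.1.shift p'.2.1.1, p'.2.1.2),
        (p'.1.shift p'.2.1.2, p'.2.1.1), (p'.1, p'.2.1.2)} : Finset (Edge d L)) → rank p < rank (u p')) ∧
      Set.InjOn u S ∧
      (Finset.univ \ B).card = (d - 1) * (d - 2) / 2 * L ^ d + (d - 1) ∧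
      (Finset.univ \ B).card ≤ (2 * (d - 1) - 1) * S.card := by
  obtain ⟨B, t, rank, -, ht, hrank, hk, -⟩ := exists_ranked_card_compl_eq (d := d) hL
  obtain ⟨rank', S, u, hrank', h1, h2, h3, h4, h5, h6⟩ :=
    exists_closingSection_of_optimal hL B t ht rank hrank hk
  exact ⟨B, t, rank', S, u, ht, hrank', h1, h2, h3, h4, h5, hk, h6⟩

/-- **`d = 3`: an optimal structure of `(ℤ/L)³` (`k = L³ + 2` plaquettes outside) with a closing section
of size `s`, `L³ + 2 ≤ 3s`.** [ours] -/
theorem exists_optimal_closingSection_three (hL : 2 ≤ L) :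
    ∃ (B : Finset (Plaquette 3 L)) (t : Plaquette 3 L → Edge 3 L) (rank : Plaquette 3 L → ℕ)
      (S : Finset (Plaquette 3 L)) (u : Plaquette 3 L → Plaquette 3 L),
      (∀ p ∈ B, t p ∈ ({(p.1, p.2.1.1), (p.1.shift p.2.1.1, p.2.1.2),
        (p.1.shift p.2.1.2, p.2.1.1), (p.1, p.2.1.2)} : Finset (Edge 3 L))) ∧
      (∀ p ∈ B, ∀ p' ∈ B, p ≠ p' → t p ∈ ({(p'.1, p'.2.1.1), (p'.1.shift p'.2.1.1, p'.2.1.2),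
        (p'.1.shift p'.2.1.2, p'.2.1.1), (p'.1, p'.2.1.2)} : Finset (Edge 3 L)) → rank p < rank p') ∧
      (∀ p' ∈ S, p' ∉ B) ∧ (∀ p' ∈ S, u p' ∈ B) ∧
      (∀ p' ∈ S, t (u p') ∈ ({(p'.1, p'.2.1.1), (p'.1.shift p'.2.1.1, p'.2.1.2),
        (p'.1.shift p'.2.1.2, p'.2.1.1), (p'.1, p'.2.1.2)} : Finset (Edge 3 L))) ∧
      (∀ p' ∈ S, ∀ p ∈ B, p ≠ u p' → t p ∈ ({(p'.1, p'.2.1.1), (p'.1.shift p'.2.1.1, p'.2.1.2),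
        (p'.1.shift p'.2.1.2, p'.2.1.1), (p'.1, p'.2.1.2)} : Finset (Edge 3 L)) → rank p < rank (u p')) ∧
      Set.InjOn u S ∧
      (Finset.univ \ B).card = L ^ 3 + 2 ∧ L ^ 3 + 2 ≤ 3 * S.card := by
  obtain ⟨B, t, rank, S, u, ht, hrank, h1, h2, h3, h4, h5, hk, h6⟩ :=
    exists_optimal_closingSection (d := 3) hL
  have e1 : (3 - 1) * (3 - 2) / 2 * L ^ 3 + (3 - 1) = L ^ 3 + 2 := by norm_num
  have e2 : 2 * (3 - 1) - 1 = 3 := by norm_num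
  rw [e1] at hk
  rw [e2] at h6
  exact ⟨B, t, rank, S, u, ht, hrank, h1, h2, h3, h4, h5, hk, by rwa [hk] at h6⟩

end Summit.Ventures.LatticeQCDFlow.Theory2.Autoregressive
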